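/-
Origin: expansion seat `planner-pub-hodgecm-mc-axioms-1-g14-0`, handover #W88 2026-08-20T15:53:55Z md5 a275f6d14314 (PKG eff525d6a383 → a275f6d14314; 255 l.; MECHANICAL (iib-R) rewrite v3.1 of the PKG file as it stands (30 token edits; rules R1x1+R2x7+RX[h₂']x13+R3x4+R8x5)) (`HOME/mc/pub-hodgecm-mc-axioms-1-g14/revendor/kit-r55/stage55/HodgeCM/Model/HLevDischarge.lean`, md5 a275f6d14314, 255 lines);
landed by the gen-22 packager (p-g22) in gate run 55 REPLACES the earlier landed copy of `HodgeCM/Model/HLevDischarge.lean` (seat copy carried the packager Origin header of an earlier run (stripped)).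
-/
/-
Origin: CONSTRUCTION seat `planner-pub-hodgecm-mc-glue-1-g6-0` (unit pub-hodgecm-mc-glue-1-g6, gen 6 of mc-glue-1, node E ASSEMBLER + (W1) root packet), 2026-08-19T15:50Z — revision (W1) of `HodgeCM/Model/HLevDischarge.lean` for the RUN-37 `Level`-pair ROOT PACKET (kit `mc/pub-hodgecm-mc-glue-1-g6/t37-mcglue1g6.txt`); base PKG 79eee3c7eb91 (mine, RUN 34; 229 l.). REPLACE — re-cut on the (W1) root: NEW `Model.exists_level_le_conj_le` (the conjugated level below `Γ` in the `K`-order, witness the pair `(Γ ∩ Γ(n d²), K ∩ K_f(n d²))`), `exists_level_conj_le` / `hLevOf` / `hLevOf_le` statements byte-identical. Kernel only: 0 `proof-hole`, 0 records, 0 `def … : Prop`, cites nothing new; expected `#print axioms` ⊆ {propext, Classical.choice, Quot.sound}.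
-/
/-
Origin: expansion seat `planner-pub-hodgecm-mc-glue-1-g4-0`, handover #313 2026-08-19T02:33Z md5 02dd40bbd660 ELIGIBLE (RUN 34 row): install after period-1-g3 #35 `Model/ThetaSatDischarge` 83e5a5043379 (in PKG, CUT #2); also imports PACKAGE `HodgeCM.Proofs.LevelDirected`. (NEW additive leaf, 225 l.; node E junction, KERNEL: the level bookkeeping binder `hLev` of E R12 PROVED — `HodgeCM.Model.hLevOf` (type = R12 binder verbatim) + `hLevOf_le`, via `exists_nat_smul_in (`HOME/mc/pub-hodgecm-mc-glue-1-g4/lean/HLevDischarge.lean`, md5 02dd40bb, 225 lines);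
landed by the gen-10 packager (p-g10) in gate run 34 as `HodgeCM/Model/HLevDischarge.lean` (verbatim).
-/
/-
Origin: CONSTRUCTION seat `planner-pub-hodgecm-mc-glue-1-g4-0` (unit pub-hodgecm-mc-glue-1-g4, gen 4 of mc-glue-1,
node E ASSEMBLER), 2026-08-19.  NEW additive leaf `HodgeCM/Model/HLevDischarge.lean` (E-junction): the level
bookkeeping binder `hLev` of E revision 12 (`Model/E2InstanceR12.lean`) PROVED.  Imports: `ThetaSatDischarge`
(mc-period-1-g3 #35: `Model.ballDatumOf_Γ_map`, and `Model.levelImage` / `Model.frameOf` below it) and the PACKAGE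
file `Proofs/LevelDirected` (`IsCongruenceSubgroup.inf`).  No proof holes, 0 records, 0 `Prop` definitions, cites
nothing.  Expected `#print axioms`: {propext, Classical.choice, Quot.sound}.
-/
import Summits.HodgeConjecture.HodgeCM.Model.ThetaSatDischarge
import Summits.HodgeConjecture.HodgeCM.Proofs.LevelDirected

/-!
# The level bookkeeping `hLev` of E revision 12, proved

For a level `Γ` of the hermitian space `V` and an `L`-rational element `γ = ρ(g)`, `g ∈ U(V)(L⁺)`, of `U(2,1)`
(`γ ∈ BallRational.ratImage L ι₁ V.Hm V.sylvesterFrame _`), there is a level `Γ' ≤ Γ` with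
`γ · ρ(Γ') · γ⁻¹ ⊆ ρ(Γ)`:

* §1 (algebra in `GL₃(L)`): clear the denominators of `g` and `g⁻¹` by `d ∈ ℕ` (`exists_integral_multiples`
  over `ℤ ⊂ ℚ ⊂ L`); if `Γ(n) ≤ Γ` then `g Γ(n d²) g⁻¹ ≤ Γ(n)` (`1 + n d² X ↦ 1 + n · (d g) X (d g⁻¹)`), so
  `Γ' := Γ ⊓ Γ(n d²)` — as a LEVEL the pair `(Γ ∩ Γ(n d²), K ∩ K_f(n d²))` (`HodgeCM.Level` carries its compact
  open `K`; `U(L⁺) ∩ K_f(m) = Γ(m)` is the vendored `UnitaryGroup.arithmeticLevel_finCongruenceLevel_span`), torsion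
  free inside `Γ`, below `Γ` in the `K`-order — has `g Γ' g⁻¹ ≤ Γ` (`Model.exists_level_le_conj_le`, and in the
  `GL₃(L)`-order `Model.exists_level_conj_le`);
* §2 (transport to `U(2,1)`): the level images `Model.levelImage Γ hV = ρ_𝔣(Γ_{D_Γ})` are read in the UNIFORM
  frame `V.sylvesterFrame` and the group of the ball datum `D_Γ` read in `GL₃(ℂ)` is `ι₁(Γ)`
  (`Model.ballDatumOf_Γ_map`), so `ρ(g) ρ(δ) ρ(g)⁻¹ = ρ(g δ g⁻¹)` lands in `ρ(Γ)` (`Model.conj_mem_levelImage`).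

`Model.hLevOf hHD hI h₁ h₃` has exactly the type of the binder `hLev` of `Model.perL_picardCM_r12core`.
-/

noncomputable section

open MulAction NumberField
open Literature.Geometry.ComplexHyperbolic.BallModel (U21 mat mat_mul)
open Literature.NumberTheory.Automorphic
open Literature.AlgebraicGeometry.HodgeTheory
open Literature.AlgebraicGeometry.ShimuraVarieties
open Literature.NumberTheory.Automorphic.PicardCM

namespace HodgeCM

namespace Model

/-! ### §1 Conjugating a deep principal congruence subgroup into `Γ(n)` -/

section Algebra

variable {L : CMField}

/-- A common denominator `d ∈ ℕ_{>0}` of the entries of `g` and `g⁻¹`. -/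
theorem exists_nat_smul_integral (g : GL (Fin 3) L) :
    ∃ d : ℕ, 0 < d ∧
      (∃ A : Matrix (Fin 3) (Fin 3) (𝓞 L), (d : L) • (g : Matrix (Fin 3) (Fin 3) L) = A.map (algebraMap (𝓞 L) L)) ∧
      (∃ B : Matrix (Fin 3) (Fin 3) (𝓞 L),
        (d : L) • ((g⁻¹ : GL (Fin 3) L) : Matrix (Fin 3) (Fin 3) L) = B.map (algebraMap (𝓞 L) L)) := by
  classical
  obtain ⟨y, hy, hint⟩ := exists_integral_multiples ℤ ℚ
    ((Finset.univ.image fun ij : Fin 3 × Fin 3 => (g : Matrix (Fin 3) (Fin 3) L) ij.1 ij.2) ∪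
      (Finset.univ.image fun ij : Fin 3 × Fin 3 => ((g⁻¹ : GL (Fin 3) L) : Matrix (Fin 3) (Fin 3) L) ij.1 ij.2))
  -- `d := |y|`, `(d : L) = ± y`
  have hcast : ((y.natAbs : ℕ) : L) = ((y.natAbs : ℤ) : L) := (Int.cast_natCast _).symm
  have hn : ((y.natAbs : ℕ) : L) = (y : L) ∨ ((y.natAbs : ℕ) : L) = -(y : L) := by
    rcases Int.natAbs_eq y with h | h
    · left; rw [hcast, ← h]
    · right; rw [hcast, show (y.natAbs : ℤ) = -y by omega, Int.cast_neg]
  have key : ∀ x : L, IsIntegral ℤ (y • x) → IsIntegral ℤ (((y.natAbs : ℕ) : L) * x) := by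
    intro x hx
    rw [zsmul_eq_mul] at hx
    rcases hn with h | h
    · rw [h]; exact hx
    · rw [h, neg_mul]; exact hx.neg
  refine ⟨y.natAbs, Int.natAbs_pos.mpr hy, ?_, ?_⟩
  · refine ⟨fun i j => ⟨((y.natAbs : ℕ) : L) * (g : Matrix (Fin 3) (Fin 3) L) i j,
      key _ (hint _ (Finset.mem_union_left _
        (Finset.mem_image.2 ⟨(i, j), Finset.mem_univ _, rfl⟩)))⟩, ?_⟩
    ext i j; rfl
  · refine ⟨fun i j => ⟨((y.natAbs : ℕ) : L) * ((g⁻¹ : GL (Fin 3) L) : Matrix (Fin 3) (Fin 3) L) i j,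
      key _ (hint _ (Finset.mem_union_right _
        (Finset.mem_image.2 ⟨(i, j), Finset.mem_univ _, rfl⟩)))⟩, ?_⟩
    ext i j; rfl

/-- `g (1 + n d² X) g⁻¹ = 1 + n · (d g) X (d g⁻¹)`: conjugation by `g` maps `≡ 1 (mod n d²)` to `≡ 1 (mod n)`
when `d g` and `d g⁻¹` are integral. -/
theorem isCongruentOneMod_conj {n d : ℕ} {g : GL (Fin 3) L} {A B : Matrix (Fin 3) (Fin 3) (𝓞 L)}
    (hA : (d : L) • (g : Matrix (Fin 3) (Fin 3) L) = A.map (algebraMap (𝓞 L) L))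
    (hB : (d : L) • ((g⁻¹ : GL (Fin 3) L) : Matrix (Fin 3) (Fin 3) L) = B.map (algebraMap (𝓞 L) L))
    {δ : Matrix (Fin 3) (Fin 3) L} (hδ : IsCongruentOneMod (n * (d * d)) δ) :
    IsCongruentOneMod n ((g : Matrix (Fin 3) (Fin 3) L) * δ * ((g⁻¹ : GL (Fin 3) L) : Matrix (Fin 3) (Fin 3) L)) := by
  obtain ⟨X, rfl⟩ := hδ
  refine ⟨A * X * B, ?_⟩
  have hgg : (g : Matrix (Fin 3) (Fin 3) L) * ((g⁻¹ : GL (Fin 3) L) : Matrix (Fin 3) (Fin 3) L) = 1 := by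
    rw [← Units.val_mul, mul_inv_cancel, Units.val_one]
  rw [Matrix.mul_add, Matrix.add_mul, Matrix.mul_one, hgg, Matrix.map_mul, Matrix.map_mul, ← hA, ← hB,
    ← Nat.cast_smul_eq_nsmul L, ← Nat.cast_smul_eq_nsmul L]
  congr 1
  simp only [Matrix.mul_smul, Matrix.smul_mul, smul_smul, Nat.cast_mul]

/-- **A level conjugated into `Γ`.** For a level `Γ` and `g ∈ U(V)(L⁺)` there is a level `Γ' ≤ Γ` (in the `K`-order
of `HodgeCM.CM.Basic`) with `g Γ' g⁻¹ ≤ Γ`: the pair `(Γ ∩ Γ(n d²), K ∩ K_f(n d²))` for `Γ(n) ≤ Γ` and `d` a common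
denominator of `g`, `g⁻¹` (`K_f(m)` compact open, `U(L⁺) ∩ K_f(m) = Γ(m)`: vendored `UnitaryGroup.isCompact_finCongruenceLevel`,
`isOpen_finCongruenceLevel`, `arithmeticLevel_finCongruenceLevel_span`). -/
theorem exists_level_le_conj_le {ι₁ : L →+* ℂ} {V : HermSpace3 L ι₁} (Γ : Level V) {g : GL (Fin 3) L}
    (hg : g ∈ unitaryGroup (conjRingHomK L) V.Hm) :
    ∃ Γ' : Level V, Γ' ≤ Γ ∧ ∀ δ ∈ Γ'.Γ, g * δ * g⁻¹ ∈ Γ.Γ := by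
  obtain ⟨_, n, hn, hle, _⟩ := Γ.isCongruence
  obtain ⟨d, hd, ⟨A, hA⟩, ⟨B, hB⟩⟩ := exists_nat_smul_integral g
  have hM : 0 < n * (d * d) := Nat.mul_pos hn (Nat.mul_pos hd hd)
  have h𝔫 : (Ideal.span {((n * (d * d) : ℕ) : 𝓞 L)} : Ideal (𝓞 L)) ≠ 0 := by
    rw [Ne, Ideal.zero_eq_bot, Ideal.span_singleton_eq_bot]; exact_mod_cast hM.ne'
  have hKo := UnitaryGroup.isOpen_finCongruenceLevel (F := ↥(maximalRealSubfield L)) (E := (L : Type))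
    (c := IsCMField.complexConj L) (N := 3) (J := V.Hm) h𝔫
  have hKc := UnitaryGroup.isCompact_finCongruenceLevel (F := ↥(maximalRealSubfield L)) (E := (L : Type))
    (c := IsCMField.complexConj L) (N := 3) (J := V.Hm) h𝔫
  refine ⟨⟨Γ.Γ ⊓ principalCongruenceSubgroup (conjRingHomK L) V.Hm (n * (d * d)),
    Γ.K ⊓ UnitaryGroup.finCongruenceLevel (↥(maximalRealSubfield L)) (L : Type) (IsCMField.complexConj L) 3 V.Hm
      (Ideal.span {((n * (d * d) : ℕ) : 𝓞 L)}),
    Γ.isCompact_K.inter_right (Subgroup.isClosed_of_isOpen _ hKo), Γ.isOpen_K.inter hKo, ?_,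
    fun γ hγ hfin => Γ.torsionFree γ hγ.1 hfin⟩, Level.le_def.mpr inf_le_left, fun δ hδ => hle ?_⟩
  · rw [UnitaryGroup.arithmeticLevel_inf, Γ.arithmeticLevel_K,
      UnitaryGroup.arithmeticLevel_finCongruenceLevel_span hM.ne']
    rfl
  obtain ⟨hδU, hδ1, hδ2⟩ := hδ.2
  refine ⟨mul_mem (mul_mem hg hδU) (inv_mem hg), ?_, ?_⟩
  · simpa only [Units.val_mul] using isCongruentOneMod_conj hA hB hδ1
  · have h' : (g * δ * g⁻¹)⁻¹ = g * δ⁻¹ * g⁻¹ := by group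
    rw [h']
    simpa only [Units.val_mul] using isCongruentOneMod_conj hA hB hδ2

/-- `exists_level_le_conj_le` in the `GL₃(L)`-order (`Level.Γ_mono`; statement of record, unchanged). -/
theorem exists_level_conj_le {ι₁ : L →+* ℂ} {V : HermSpace3 L ι₁} (Γ : Level V) {g : GL (Fin 3) L}
    (hg : g ∈ unitaryGroup (conjRingHomK L) V.Hm) :
    ∃ Γ' : Level V, Γ'.Γ ≤ Γ.Γ ∧ ∀ δ ∈ Γ'.Γ, g * δ * g⁻¹ ∈ Γ.Γ := by
  obtain ⟨Γ', hle, h⟩ := exists_level_le_conj_le Γ hg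
  exact ⟨Γ', Level.Γ_mono hle, h⟩

end Algebra

/-! ### §2 Transport to `U(2,1)` through the uniform frame -/

section Transport

variable (hHD : exists_isReal_hodgeModel) (hI : hodgePQ_independent_of_hodgeModel)
  (h₁ : BallQuotientUniformised)  (h₃ : CMAbelianVarietyRealised)

variable {L : CMField} {ι₁ : L →+* ℂ} {V : HermSpace3 L ι₁}

/-- The CM conjugation of `L` as Mathlib's `complexConj` coerced to a ring hom is the PKG's `conjRingHomK L`. -/
theorem coe_complexConj_eq_conjRingHomK : (IsCMField.complexConj L : L →+* L) = conjRingHomK L :=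
  RingHom.ext fun _ => rfl

/-- **`ρ(g) ρ(Γ') ρ(g)⁻¹ ⊆ ρ(Γ)` when `g Γ' g⁻¹ ≤ Γ`** (all images in `U(2,1)` read in the uniform frame
`V.sylvesterFrame`; the data `D_{Γ'}`, `D_Γ` have groups `ι₁(Γ')`, `ι₁(Γ)` in `GL₃(ℂ)` by `ballDatumOf_Γ_map`). -/
theorem conj_mem_levelImage (hV : IsAnisotropic L V.Hm) {Γ Γ' : Level V}
    (g : unitaryGroup (IsCMField.complexConj L : L →+* L) V.Hm)
    (hconj : ∀ δ ∈ Γ'.Γ, (g : GL (Fin 3) L) * δ * (g : GL (Fin 3) L)⁻¹ ∈ Γ.Γ)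
    {δ' : U21} (hδ' : δ' ∈ levelImage hHD hI h₁ h₃ Γ' hV) :
    BallRational.toBall L ι₁ V.Hm V.sylvesterFrame (sylvesterFrame_J V) g * δ' *
        (BallRational.toBall L ι₁ V.Hm V.sylvesterFrame (sylvesterFrame_J V) g)⁻¹ ∈
      levelImage hHD hI h₁ h₃ Γ hV := by
  rw [levelImage, UnitaryBallUniformisationDatum.ballImage, Subgroup.mem_map] at hδ'
  obtain ⟨γ', -, rfl⟩ := hδ'
  -- `γ' ∈ Γ_{D_{Γ'}}` comes from some `δ ∈ Γ'`
  have h1 : Matrix.GeneralLinearGroup.map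
      ((ballDatumOf (hHD := hHD) (hI := hI) (hU := ballQuotientUniformisedDatum_of h₁) (h₃ := h₃)
        L ι₁ V Γ' hV).E.subtype : _ →+* ℂ) (γ' : GL (Fin 3) _) ∈
        Γ'.Γ.map (Matrix.GeneralLinearGroup.map ι₁) := by
    rw [← ballDatumOf_Γ_map hHD hI h₃ (ballQuotientUniformisedDatum_of h₁) Γ' hV]
    exact Subgroup.mem_map_of_mem _ γ'.2
  obtain ⟨δ, hδ, hδe⟩ := h1
  -- `g δ g⁻¹ ∈ Γ` is the image of some `γ₀ ∈ Γ_{D_Γ}`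
  have h2 : Matrix.GeneralLinearGroup.map ι₁ ((g : GL (Fin 3) L) * δ * (g : GL (Fin 3) L)⁻¹) ∈
      (ballDatumOf (hHD := hHD) (hI := hI) (hU := ballQuotientUniformisedDatum_of h₁) (h₃ := h₃)
        L ι₁ V Γ hV).Γ.map
        (Matrix.GeneralLinearGroup.map
          ((ballDatumOf (hHD := hHD) (hI := hI) (hU := ballQuotientUniformisedDatum_of h₁) (h₃ := h₃)
            L ι₁ V Γ hV).E.subtype : _ →+* ℂ)) := by
    rw [ballDatumOf_Γ_map hHD hI h₃ (ballQuotientUniformisedDatum_of h₁) Γ hV]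
    exact Subgroup.mem_map_of_mem _ (hconj δ hδ)
  obtain ⟨γ₀, hγ₀, hγ₀e⟩ := h2
  rw [levelImage, UnitaryBallUniformisationDatum.ballImage, Subgroup.mem_map]
  refine ⟨⟨γ₀, hγ₀⟩, Subgroup.mem_top _, ?_⟩
  -- compare matrices in `GL₃(ℂ)`
  have e1 : ((γ'.1 : GL (Fin 3) _) : Matrix (Fin 3) (Fin 3) _).map
      (ballDatumOf (hHD := hHD) (hI := hI) (hU := ballQuotientUniformisedDatum_of h₁) (h₃ := h₃) L ι₁ V Γ' hV).τ₁ =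
        ((δ : GL (Fin 3) L) : Matrix (Fin 3) (Fin 3) L).map ι₁ := by
    simpa [Matrix.GeneralLinearGroup.val_map_apply] using
      congrArg (fun x : GL (Fin 3) ℂ => (x : Matrix (Fin 3) (Fin 3) ℂ)) hδe.symm
  have e2 : ((γ₀ : GL (Fin 3) _) : Matrix (Fin 3) (Fin 3) _).map
      (ballDatumOf (hHD := hHD) (hI := hI) (hU := ballQuotientUniformisedDatum_of h₁) (h₃ := h₃) L ι₁ V Γ hV).τ₁ =
        (((g : GL (Fin 3) L) * δ * (g : GL (Fin 3) L)⁻¹ : GL (Fin 3) L) : Matrix (Fin 3) (Fin 3) L).map ι₁ := by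
    have := congrArg (fun x : GL (Fin 3) ℂ => (x : Matrix (Fin 3) (Fin 3) ℂ)) hγ₀e
    simp only [Matrix.GeneralLinearGroup.val_map_apply] at this
    exact this
  apply Subtype.ext
  apply Units.ext
  change mat _ = mat _
  rw [mat_mul, mat_mul, ← map_inv, UnitaryBallUniformisationDatum.mat_ballRep, UnitaryBallUniformisationDatum.mat_ballRep,
    BallRational.mat_toBall, BallRational.mat_toBall]
  have hT : (frameOf hHD hI h₁ h₃ Γ hV).t = (V.sylvesterFrame : Matrix (Fin 3) (Fin 3) ℂ) := rfl
  have hT' : (frameOf hHD hI h₁ h₃ Γ' hV).t = (V.sylvesterFrame : Matrix (Fin 3) (Fin 3) ℂ) := rfl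
  have hTi : (frameOf hHD hI h₁ h₃ Γ hV).ti = ((V.sylvesterFrame⁻¹ : GL (Fin 3) ℂ) : Matrix (Fin 3) (Fin 3) ℂ) :=
    rfl
  have hTi' : (frameOf hHD hI h₁ h₃ Γ' hV).ti =
      ((V.sylvesterFrame⁻¹ : GL (Fin 3) ℂ) : Matrix (Fin 3) (Fin 3) ℂ) := rfl
  have hcancel : ∀ X : Matrix (Fin 3) (Fin 3) ℂ,
      (V.sylvesterFrame : Matrix (Fin 3) (Fin 3) ℂ) * (((V.sylvesterFrame⁻¹ : GL (Fin 3) ℂ) : Matrix (Fin 3) (Fin 3) ℂ) * X) =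
        X := fun X => by
    rw [← Matrix.mul_assoc, ← Units.val_mul, mul_inv_cancel, Units.val_one, Matrix.one_mul]
  rw [hT, hTi, hT', hTi', Subgroup.coe_mk, e2, e1]
  simp only [Units.val_mul, Matrix.map_mul, Subgroup.coe_inv, Matrix.mul_assoc, hcancel]

/-- **The binder `hLev` of `Model.perL_picardCM_r12core`, PROVED**: below any level `Γ` and for any `L`-rational
`γ ∈ U(2,1)` there is a level `Γ'` with `γ ρ(Γ') γ⁻¹ ⊆ ρ(Γ)`. -/
theorem hLevOf {L : CMField} {ι₁ : L →+* ℂ} (V : HermSpace3 L ι₁) (hV : IsAnisotropic L V.Hm) (Γ : Level V) :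
    ∀ γ ∈ Literature.AlgebraicGeometry.ShimuraVarieties.BallRational.ratImage L ι₁ V.Hm V.sylvesterFrame
        (sylvesterFrame_J V),
      ∃ Γ' : Level V, ∀ δ' ∈ levelImage hHD hI h₁ h₃ Γ' hV,
        γ * δ' * γ⁻¹ ∈ levelImage hHD hI h₁ h₃ Γ hV := by
  rintro γ ⟨g, rfl⟩
  have hg : (g : GL (Fin 3) L) ∈ unitaryGroup (conjRingHomK L) V.Hm := by
    rw [← coe_complexConj_eq_conjRingHomK]; exact g.2
  obtain ⟨Γ', -, hconj⟩ := exists_level_conj_le Γ hg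
  exact ⟨Γ', fun δ' hδ' => conj_mem_levelImage hHD hI h₁ h₃ hV g hconj hδ'⟩

/-- `hLevOf` also records `Γ' ≤ Γ` (for consumers that need the smaller level to lie below `Γ`). -/
theorem hLevOf_le {L : CMField} {ι₁ : L →+* ℂ} (V : HermSpace3 L ι₁) (hV : IsAnisotropic L V.Hm) (Γ : Level V) :
    ∀ γ ∈ Literature.AlgebraicGeometry.ShimuraVarieties.BallRational.ratImage L ι₁ V.Hm V.sylvesterFrame
        (sylvesterFrame_J V),
      ∃ Γ' : Level V, Γ'.Γ ≤ Γ.Γ ∧ ∀ δ' ∈ levelImage hHD hI h₁ h₃ Γ' hV,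
        γ * δ' * γ⁻¹ ∈ levelImage hHD hI h₁ h₃ Γ hV := by
  rintro γ ⟨g, rfl⟩
  have hg : (g : GL (Fin 3) L) ∈ unitaryGroup (conjRingHomK L) V.Hm := by
    rw [← coe_complexConj_eq_conjRingHomK]; exact g.2
  obtain ⟨Γ', hle, hconj⟩ := exists_level_conj_le Γ hg
  exact ⟨Γ', hle, fun δ' hδ' => conj_mem_levelImage hHD hI h₁ h₃ hV g hconj hδ'⟩

end Transport

end Model

end HodgeCM

end
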